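import Literature.MathematicalPhysics.QuantumFieldTheory.Balaban1983to89.B1Eq324BenfattoTwoStage
import Literature.MathematicalPhysics.QuantumFieldTheory.Balaban1983to89.B1Eq324BenfattoCondLaw
import HarnessLib

/-!
# `Balaban1983to89.B1Eq324BenfattoTwoStageLaw` — [BenfattoEtAl1978] p. 152 / §5 p. 159: CONDITIONING IN TWO STAGES, the MEASURE half —
# `P̂₀(·|z̄_C)` conditioned on the corridor variables `z_Γ` is `P̂₀(·|z̄_C, z_Γ)`: the disintegration of n08-b's `…CondLaw` re-run for a GENERAL
# positive-semidefinite kernel with invertible Gram matrix (§A), then specialised to the Dirichlet kernel `C^C` and transported by the centre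
# `u_C(z̄)` (§B), PROVED

statement-level skeleton of published theorems with citation tags; proofs where landed; nothing here is a claim about the
Yang–Mills mass gap

WHY THIS MODULE (cell `pub-ymgap`, seat `dag-n08-d` gen 9, INTENT-36; node N08 [Balaban1985UV3]; the [BenfattoEtAl1978] source chain behind the
(α)-row `h324c`).  The upper bound (4.6) is stated for `P̄ = P̂₀(·|(z̄_Δ)_{Δ∈C})` and proved (p. 159 «We start from (5.13) …») by conditioning `P̄`
further on `z_{Γ₁}`.  `…B1Eq324BenfattoTwoStage` proved the algebraic half (`condCov K (C∪Γ) = condCov (condCov K C) Γ`, the centre formula, the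
Gram matrix of `C^C` on `Γ` invertible).  Here: §A = n08-b's coupling/disintegration (`…CondLaw`, written there for `P̂₀ = 𝒩(0, K)`, `K = freeCov`)
with the kernel as a PARAMETER — any positive-semidefinite `K` whose Gram matrix on `Γ` is invertible and whose Dirichlet kernel `condCov K Γ` is
positive-semidefinite (proofs verbatim, the three free-field facts replaced by hypotheses); §B = the instance `K := C^C` (all three hypotheses hold:
`isPosSemidefKernel_condCov_freeCov`, `…TwoStage.isUnit_det_covGram_condCov_freeCov`, and `condCov C^C Γ = C^{C∪Γ}`), transported along the shift by
`u_C(z̄)` that turns `𝒩(0, C^C)` into `condField C z̄`, with the inner law identified as `condField (C ∪ Γ) ξ` by `…TwoStage.condMean_union_eq`.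

WHAT IS PROVED (standard axioms; no `sorry`; no definition).
* §A (generic `K`): `covariance_condMean`, `map_coupling_eq`, `condCov_self_eq_zero_of_mem`, `schurField_eval_ae_eq_zero`, `coupling_apply_ae_eq_of_mem`,
  ★ `integral_gaussianFieldOfKernel_eq_condLaw` (`∫ g(ξ|_Γ, ξ) d𝒩(0,K) = ∫ (∫ g(ξ|_Γ, z) d[𝒩(0, condCov K Γ) ∘ (ζ ↦ u_Γ(ξ) + ζ)⁻¹]) d𝒩(0,K)`).
* §B ★★★ `integral_condField_eq_integral_condField_union` — for `α, β > 0`, disjoint finite `C`, `Γ`, data `z̄` and bounded measurable `g`: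
  `∫ g(ξ|_Γ, ξ) dP̂₀(·|z̄_C)(ξ) = ∫ (∫ g(ξ|_Γ, z) dP̂₀(·|ξ_{C∪Γ})(z)) dP̂₀(·|z̄_C)(ξ)` — `ξ ↦ condField (C ∪ Γ) ξ` is a conditional law of `condField C z̄`
  given the `Γ`-coordinates (it reads `ξ` on `C ∪ Γ`; on `C`, `ξ = z̄` a.s.).
HONEST SCOPE.  The consumer — the upper pavement step (5.36) with outer measure `P̂₀(·|z̄_C)` and hence (4.6) for `C ≠ ∅` — is NOT here; count-neutral
for N08; `BasicLemmaPrinted` NOT discharged; nothing about d = 4, the continuum, OS axioms, a mass gap or the Clay problem.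
-/

noncomputable section

open MeasureTheory ProbabilityTheory Finset Matrix
open scoped BigOperators Matrix NNReal ENNReal

namespace Literature.MathematicalPhysics.QuantumFieldTheory.Balaban1983to89.B1Eq324BenfattoTwoStageLaw

open Literature.MathematicalPhysics.QuantumFieldTheory
open Literature.MathematicalPhysics.QuantumFieldTheory.Balaban1983to89.B1Eq324BenfattoLemma
open Literature.MathematicalPhysics.QuantumFieldTheory.Balaban1983to89.B1Eq324BenfattoCondCentre
open Literature.MathematicalPhysics.QuantumFieldTheory.Balaban1983to89.B1Eq324BenfattoAppendixCLemma2
open Literature.MathematicalPhysics.QuantumFieldTheory.Balaban1983to89.B1Eq324BenfattoAppendixC2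
open Literature.MathematicalPhysics.QuantumFieldTheory.Balaban1983to89.B1Eq324BenfattoCondLaw (condMean_eq_sum_weight_mul)
open Literature.MathematicalPhysics.QuantumFieldTheory.Balaban1983to89.B1Eq324BenfattoTwoStage

variable {d : ℕ}

/-! ## §A  The coupling and the disintegration for a general kernel -/

/-- kernel: a positive-semidefinite kernel is symmetric (its `2 × 2` Gram matrices are Hermitian). [folklore] -/
private theorem kernel_comm {K : B1Eq324BenfattoLemma.Site d → B1Eq324BenfattoLemma.Site d → ℝ} (hK : IsPosSemidefKernel K)
    (x y : B1Eq324BenfattoLemma.Site d) : K x y = K y x := by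
  classical
  have h := (hK ({x, y} : Finset _)).isHermitian
  have hx : x ∈ ({x, y} : Finset (B1Eq324BenfattoLemma.Site d)) := by simp
  have hy : y ∈ ({x, y} : Finset (B1Eq324BenfattoLemma.Site d)) := by simp
  have := congrFun (congrFun h ⟨x, hx⟩) ⟨y, hy⟩
  simpa [Matrix.conjTranspose_apply, covGram_apply] using this.symm


/-! ## §1  The coupling `W(ξ, ζ) = u(ξ) + ζ` on `P̂₀ ⊗ Q` has law `P̂₀` -/

section Coupling

variable {K : B1Eq324BenfattoLemma.Site d → B1Eq324BenfattoLemma.Site d → ℝ} (hKpsd : IsPosSemidefKernel K)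
  (Γ : Finset (B1Eq324BenfattoLemma.Site d)) (hdet : IsUnit (covGram K Γ).det) (hKc : IsPosSemidefKernel (condCov K Γ))

include hKpsd hdet hKc

omit hKc in
/-- **Law of total covariance for the regression**: `Cov_{P̂₀}(u_s, u_t) = K(s,t) − C^Γ(s,t)` — the covariance of the regression means
is the free covariance minus the conditional one (`K_sΓ K_ΓΓ⁻¹ K_ΓΓ K_ΓΓ⁻¹ K_Γt = K_sΓ K_ΓΓ⁻¹ K_Γt`, `K_ΓΓ` invertible).
[cite: BenfattoEtAl1978, Appendix C (C.6)–(C.7) p.164] -/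
theorem covariance_condMean (s t : B1Eq324BenfattoLemma.Site d) :
    cov[fun ξ => condMean (K) Γ ξ s, fun ξ => condMean (K) Γ ξ t; gaussianFieldOfKernel K] =
      K s t - condCov (K) Γ s t := by
  haveI : IsProbabilityMeasure (gaussianFieldOfKernel K) := isProbabilityMeasure_gaussianFieldOfKernel hKpsd
  set A : Matrix Γ Γ ℝ := covGram K Γ with hA
  have hKs : ∀ x y, K x y = K y x := fun x y => kernel_comm hKpsd x y
  have hAs : ∀ c c' : Γ, A c c' = A c' c := fun c c' => by simp only [hA, covGram_apply, hKs]
  have hAinv : ∀ c c' : Γ, A⁻¹ c c' = A⁻¹ c' c := by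
    intro c c'
    have hAt : Aᵀ = A := by ext i j; exact hAs j i
    have h := congrFun (congrFun (Matrix.transpose_nonsing_inv A) c') c
    rw [Matrix.transpose_apply, hAt] at h
    exact h
  -- weights
  set w : B1Eq324BenfattoLemma.Site d → Γ → ℝ := fun r c' => ∑ c : Γ, K r c * A⁻¹ c c' with hw
  have hu : ∀ r, (fun ξ : B1Eq324BenfattoLemma.Site d → ℝ => condMean K Γ ξ r) =
      fun ξ => ∑ c' : Γ, w r c' * ξ c' := fun r => funext fun ξ => condMean_eq_sum_weight_mul Γ K ξ r
  have hmem : ∀ c : Γ, MemLp (fun ξ : B1Eq324BenfattoLemma.Site d → ℝ => ξ c) 2 (gaussianFieldOfKernel K) := fun c =>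
    ((isGaussianProcess_eval_gaussianFieldOfKernel hKpsd).hasGaussianLaw_eval (c : B1Eq324BenfattoLemma.Site d)).memLp_two
  rw [hu s, hu t, covariance_fun_sum_fun_sum (fun c' => (hmem c').const_mul _) (fun c' => (hmem c').const_mul _)]
  simp only [covariance_const_mul_left, covariance_const_mul_right]
  have hcov : ∀ i j : Γ, cov[fun ξ : B1Eq324BenfattoLemma.Site d → ℝ => ξ i, fun ξ => ξ j; gaussianFieldOfKernel K] = A i j := by
    intro i j
    rw [hA, covGram_apply]
    exact covariance_eval_gaussianFieldOfKernel hKpsd _ _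
  simp only [hcov]
  -- `Σ_i Σ_j w_s i w_t j A i j = Σ_j K s j w_t j = K s t − condCov s t`
  have hstep : ∀ j : Γ, ∑ i : Γ, w s i * A i j = K s j := by
    intro j
    have e : ∑ i : Γ, w s i * A i j = ∑ c : Γ, K s c * (A⁻¹ * A) c j := by
      simp only [hw, Finset.sum_mul, Matrix.mul_apply, Finset.mul_sum]
      rw [Finset.sum_comm]
      exact Finset.sum_congr rfl fun c _ => Finset.sum_congr rfl fun i _ => by ring
    rw [e, Matrix.nonsing_inv_mul _ hdet]
    simp [Matrix.one_apply]
  calc ∑ i : Γ, ∑ j : Γ, w t j * (w s i * A i j)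
      = ∑ j : Γ, (∑ i : Γ, w s i * A i j) * w t j := by
        rw [Finset.sum_comm]
        refine Finset.sum_congr rfl fun j _ => ?_
        rw [Finset.sum_mul]
        refine Finset.sum_congr rfl fun i _ => ?_
        ring
    _ = ∑ j : Γ, K s j * w t j := by simp only [hstep]
    _ = K s t - condCov K Γ s t := by
        simp only [condCov, sub_sub_cancel, hw, Finset.mul_sum]
        refine Finset.sum_congr rfl fun c _ => Finset.sum_congr rfl fun j _ => ?_
        rw [hAinv j c, hKs (t : B1Eq324BenfattoLemma.Site d) j]
        ring

/-- **The coupling reproduces the free field**: with `Q` the centred Gaussian field of the conditional covariance `C^Γ` and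
`W(ξ, ζ) = u(ξ) + ζ`, the image of `P̂₀ ⊗ Q` under `W` is `P̂₀` — `W` is a centred Gaussian process (a linear image of the
independent Gaussian pair `(ξ|_Γ, ζ)`) with covariance `(K − C^Γ) + C^Γ = K`, and Gaussian laws are determined by mean and
covariance. [cite: Kallenberg2002, Lemma 13.1] -/
theorem map_coupling_eq :
    ((gaussianFieldOfKernel K).prod (gaussianFieldOfKernel (condCov (K) Γ))).map
        (fun p : (B1Eq324BenfattoLemma.Site d → ℝ) × (B1Eq324BenfattoLemma.Site d → ℝ) =>
          fun x => condMean (K) Γ p.1 x + p.2 x) = gaussianFieldOfKernel K := by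
  set μ := gaussianFieldOfKernel K with hμ
  set Q := gaussianFieldOfKernel (condCov K Γ) with hQ
  haveI : IsProbabilityMeasure μ := isProbabilityMeasure_gaussianFieldOfKernel hKpsd
  haveI : IsProbabilityMeasure Q := isProbabilityMeasure_gaussianFieldOfKernel hKc
  set ν := μ.prod Q with hν
  have hfst : ν.map Prod.fst = μ := by rw [hν, Measure.map_fst_prod, measure_univ, one_smul]
  have hsnd : ν.map Prod.snd = Q := by rw [hν, Measure.map_snd_prod, measure_univ, one_smul]
  -- the two processes on `ν`
  set X : B1Eq324BenfattoLemma.Site d → ((B1Eq324BenfattoLemma.Site d → ℝ) × (B1Eq324BenfattoLemma.Site d → ℝ)) → ℝ :=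
    fun s p => p.1 s with hX
  set Y : B1Eq324BenfattoLemma.Site d → ((B1Eq324BenfattoLemma.Site d → ℝ) × (B1Eq324BenfattoLemma.Site d → ℝ)) → ℝ :=
    fun s p => condMean K Γ p.1 s + p.2 s with hY
  have hμproc : IsGaussianProcess (fun (s : B1Eq324BenfattoLemma.Site d) (ξ : B1Eq324BenfattoLemma.Site d → ℝ) => ξ s) μ :=
    isGaussianProcess_eval_gaussianFieldOfKernel hKpsd
  have hQproc : IsGaussianProcess (fun (s : B1Eq324BenfattoLemma.Site d) (ζ : B1Eq324BenfattoLemma.Site d → ℝ) => ζ s) Q :=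
    isGaussianProcess_eval_gaussianFieldOfKernel hKc
  -- measurability helpers
  have hres : ∀ I : Finset (B1Eq324BenfattoLemma.Site d),
      Measurable fun ω : B1Eq324BenfattoLemma.Site d → ℝ => I.restrict fun s => ω s :=
    fun I => measurable_pi_lambda _ fun s => measurable_pi_apply _
  have hum : ∀ s, Measurable fun ξ : B1Eq324BenfattoLemma.Site d → ℝ => condMean K Γ ξ s := by
    intro s
    simp only [condMean]
    fun_prop
  have hYm : ∀ s, Measurable (Y s) := fun s =>
    ((hum s).comp measurable_fst).add ((measurable_pi_apply s).comp measurable_snd)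
  -- X is a Gaussian process on ν (law of the first marginal)
  have hXproc : IsGaussianProcess X ν := by
    refine ⟨fun I => ⟨?_⟩⟩
    have hcomp : (fun ω => I.restrict fun s => X s ω) =
        (fun ω : B1Eq324BenfattoLemma.Site d → ℝ => I.restrict fun s => ω s) ∘ Prod.fst := rfl
    rw [hcomp, ← Measure.map_map (hres I) measurable_fst, hfst]
    exact (hμproc.hasGaussianLaw I).isGaussian_map
  -- Y is a Gaussian process on ν: a linear image of the independent Gaussian pair (ξ|Γ, ζ|I)
  have hYproc : IsGaussianProcess Y ν := by
    refine ⟨fun I => ?_⟩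
    -- the pair
    have h1 : HasGaussianLaw (fun p : (B1Eq324BenfattoLemma.Site d → ℝ) × (B1Eq324BenfattoLemma.Site d → ℝ) =>
        Γ.restrict fun s => p.1 s) ν := by
      refine ⟨?_⟩
      have hcomp : (fun p : (B1Eq324BenfattoLemma.Site d → ℝ) × (B1Eq324BenfattoLemma.Site d → ℝ) =>
          Γ.restrict fun s => p.1 s) = (fun ω : B1Eq324BenfattoLemma.Site d → ℝ => Γ.restrict fun s => ω s) ∘ Prod.fst := rfl
      rw [hcomp, ← Measure.map_map (hres Γ) measurable_fst, hfst]
      exact (hμproc.hasGaussianLaw Γ).isGaussian_map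
    have h2 : HasGaussianLaw (fun p : (B1Eq324BenfattoLemma.Site d → ℝ) × (B1Eq324BenfattoLemma.Site d → ℝ) =>
        I.restrict fun s => p.2 s) ν := by
      refine ⟨?_⟩
      have hcomp : (fun p : (B1Eq324BenfattoLemma.Site d → ℝ) × (B1Eq324BenfattoLemma.Site d → ℝ) =>
          I.restrict fun s => p.2 s) = (fun ω : B1Eq324BenfattoLemma.Site d → ℝ => I.restrict fun s => ω s) ∘ Prod.snd := rfl
      rw [hcomp, ← Measure.map_map (hres I) measurable_snd, hsnd]
      exact (hQproc.hasGaussianLaw I).isGaussian_map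
    have hind : IndepFun (fun p : (B1Eq324BenfattoLemma.Site d → ℝ) × (B1Eq324BenfattoLemma.Site d → ℝ) =>
        Γ.restrict fun s => p.1 s) (fun p => I.restrict fun s => p.2 s) ν :=
      indepFun_prod (hres Γ) (hres I)
    have hpair := IndepFun.hasGaussianLaw h1 h2 hind
    -- the linear map
    let L : ((Γ → ℝ) × (I → ℝ)) →L[ℝ] (I → ℝ) :=
      { toFun := fun ab s => (∑ c' : Γ, (∑ c : Γ, K s c * (covGram K Γ)⁻¹ c c') * ab.1 c') + ab.2 s
        map_add' := fun x y => by
          funext s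
          simp only [Prod.fst_add, Prod.snd_add, Pi.add_apply, mul_add, Finset.sum_add_distrib]
          ring
        map_smul' := fun m x => by
          funext s
          simp only [Prod.smul_fst, Prod.smul_snd, Pi.smul_apply, smul_eq_mul, RingHom.id_apply]
          rw [mul_add, Finset.mul_sum]
          congr 1
          exact Finset.sum_congr rfl fun i _ => by ring
        cont := by fun_prop }
    have hfun : (fun ω => I.restrict fun s => Y s ω) =
        L ∘ fun p => (Γ.restrict fun s => p.1 s, I.restrict fun s => p.2 s) := by
      funext p s
      simp only [hY, Function.comp_apply, Finset.restrict, condMean_eq_sum_weight_mul]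
      rfl
    rw [hfun]
    exact hpair.map L
  -- means
  have hmX : ∀ s, ν[X s] = 0 := by
    intro s
    have h := integral_map (μ := ν) (φ := Prod.fst) measurable_fst.aemeasurable
      (f := fun ω : B1Eq324BenfattoLemma.Site d → ℝ => ω s) (measurable_pi_apply s).aestronglyMeasurable
    rw [hfst] at h
    rw [hX]
    simp only
    rw [← h, hμ]
    exact integral_eval_gaussianFieldOfKernel hKpsd s
  have hmu : ∀ s, ∫ ξ, condMean K Γ ξ s ∂μ = 0 := by
    intro s
    rw [show (fun ξ : B1Eq324BenfattoLemma.Site d → ℝ => condMean K Γ ξ s) = fun ξ => ∑ c' : Γ,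
        (∑ c : Γ, K s c * (covGram K Γ)⁻¹ c c') * ξ c' from funext fun ξ => condMean_eq_sum_weight_mul Γ K ξ s]
    rw [integral_finsetSum _ fun c' _ => ?_]
    · refine Finset.sum_eq_zero fun c' _ => ?_
      rw [integral_const_mul, hμ, integral_eval_gaussianFieldOfKernel hKpsd, mul_zero]
    · exact ((hμproc.hasGaussianLaw_eval (c' : B1Eq324BenfattoLemma.Site d)).integrable).const_mul _
  have hmY : ∀ s, ν[Y s] = 0 := by
    intro s
    have hi1 : Integrable (fun p : (B1Eq324BenfattoLemma.Site d → ℝ) × (B1Eq324BenfattoLemma.Site d → ℝ) =>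
        condMean K Γ p.1 s) ν := by
      have : Integrable (fun ξ : B1Eq324BenfattoLemma.Site d → ℝ => condMean K Γ ξ s) (ν.map Prod.fst) := by
        rw [hfst]
        rw [show (fun ξ : B1Eq324BenfattoLemma.Site d → ℝ => condMean K Γ ξ s) = fun ξ => ∑ c' : Γ,
            (∑ c : Γ, K s c * (covGram K Γ)⁻¹ c c') * ξ c' from funext fun ξ => condMean_eq_sum_weight_mul Γ K ξ s]
        exact integrable_finsetSum _ fun c' _ =>
          ((hμproc.hasGaussianLaw_eval (c' : B1Eq324BenfattoLemma.Site d)).integrable).const_mul _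
      exact (integrable_map_measure (hum s).aestronglyMeasurable measurable_fst.aemeasurable).1 this
    have hi2 : Integrable (fun p : (B1Eq324BenfattoLemma.Site d → ℝ) × (B1Eq324BenfattoLemma.Site d → ℝ) => p.2 s) ν := by
      have : Integrable (fun ζ : B1Eq324BenfattoLemma.Site d → ℝ => ζ s) (ν.map Prod.snd) := by
        rw [hsnd]
        exact (hQproc.hasGaussianLaw_eval s).integrable
      exact (integrable_map_measure (measurable_pi_apply s).aestronglyMeasurable measurable_snd.aemeasurable).1 this
    rw [hY]
    simp only
    rw [integral_add hi1 hi2]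
    have e1 : ∫ p, condMean K Γ p.1 s ∂ν = ∫ ξ, condMean K Γ ξ s ∂μ := by
      have h := integral_map (μ := ν) (φ := Prod.fst) measurable_fst.aemeasurable
        (f := fun ξ : B1Eq324BenfattoLemma.Site d → ℝ => condMean K Γ ξ s) (hum s).aestronglyMeasurable
      rw [hfst] at h
      exact h.symm
    have e2 : ∫ p : (B1Eq324BenfattoLemma.Site d → ℝ) × (B1Eq324BenfattoLemma.Site d → ℝ), p.2 s ∂ν = ∫ ζ, ζ s ∂Q := by
      have h := integral_map (μ := ν) (φ := Prod.snd) measurable_snd.aemeasurable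
        (f := fun ζ : B1Eq324BenfattoLemma.Site d → ℝ => ζ s) (measurable_pi_apply s).aestronglyMeasurable
      rw [hsnd] at h
      exact h.symm
    rw [e1, e2, hmu, hQ, integral_eval_gaussianFieldOfKernel hKc, add_zero]
  -- covariances
  have hcX : ∀ s t, cov[X s, X t; ν] = K s t := by
    intro s t
    have h := covariance_map (μ := ν) (Z := Prod.fst) (X := fun ω : B1Eq324BenfattoLemma.Site d → ℝ => ω s)
      (Y := fun ω : B1Eq324BenfattoLemma.Site d → ℝ => ω t) (measurable_pi_apply s).aestronglyMeasurable
      (measurable_pi_apply t).aestronglyMeasurable measurable_fst.aemeasurable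
    rw [hfst] at h
    rw [hX]
    change cov[(fun ω : B1Eq324BenfattoLemma.Site d → ℝ => ω s) ∘ Prod.fst,
      (fun ω : B1Eq324BenfattoLemma.Site d → ℝ => ω t) ∘ Prod.fst; ν] = K s t
    rw [← h, hμ]
    exact covariance_eval_gaussianFieldOfKernel hKpsd s t
  have hL2u : ∀ s, MemLp (fun p : (B1Eq324BenfattoLemma.Site d → ℝ) × (B1Eq324BenfattoLemma.Site d → ℝ) =>
      condMean K Γ p.1 s) 2 ν := by
    intro s
    have : MemLp (fun ξ : B1Eq324BenfattoLemma.Site d → ℝ => condMean K Γ ξ s) 2 μ := by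
      rw [show (fun ξ : B1Eq324BenfattoLemma.Site d → ℝ => condMean K Γ ξ s) = fun ξ => ∑ c' : Γ,
          (∑ c : Γ, K s c * (covGram K Γ)⁻¹ c c') * ξ c' from funext fun ξ => condMean_eq_sum_weight_mul Γ K ξ s]
      exact memLp_finsetSum _ fun c' _ =>
        ((hμproc.hasGaussianLaw_eval (c' : B1Eq324BenfattoLemma.Site d)).memLp_two).const_mul _
    exact this.comp_fst Q
  have hL2ζ : ∀ s, MemLp (fun p : (B1Eq324BenfattoLemma.Site d → ℝ) × (B1Eq324BenfattoLemma.Site d → ℝ) => p.2 s) 2 ν :=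
    fun s => ((hQproc.hasGaussianLaw_eval s).memLp_two).comp_snd μ
  have hcross : ∀ s t, cov[fun p : (B1Eq324BenfattoLemma.Site d → ℝ) × (B1Eq324BenfattoLemma.Site d → ℝ) => condMean K Γ p.1 s,
      fun p => p.2 t; ν] = 0 := fun s t =>
    covariance_fst_snd_prod (X := fun ξ : B1Eq324BenfattoLemma.Site d → ℝ => condMean K Γ ξ s)
      (Y := fun ζ : B1Eq324BenfattoLemma.Site d → ℝ => ζ t)
      (by
        rw [show (fun ξ : B1Eq324BenfattoLemma.Site d → ℝ => condMean K Γ ξ s) = fun ξ => ∑ c' : Γ,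
            (∑ c : Γ, K s c * (covGram K Γ)⁻¹ c c') * ξ c' from funext fun ξ => condMean_eq_sum_weight_mul Γ K ξ s]
        exact memLp_finsetSum _ fun c' _ =>
          ((hμproc.hasGaussianLaw_eval (c' : B1Eq324BenfattoLemma.Site d)).memLp_two).const_mul _)
      ((hQproc.hasGaussianLaw_eval t).memLp_two)
  have hcuu : ∀ s t, cov[fun p : (B1Eq324BenfattoLemma.Site d → ℝ) × (B1Eq324BenfattoLemma.Site d → ℝ) => condMean K Γ p.1 s,
      fun p => condMean K Γ p.1 t; ν] = K s t - condCov K Γ s t := by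
    intro s t
    have h := covariance_map (μ := ν) (Z := Prod.fst) (X := fun ξ : B1Eq324BenfattoLemma.Site d → ℝ => condMean K Γ ξ s)
      (Y := fun ξ : B1Eq324BenfattoLemma.Site d → ℝ => condMean K Γ ξ t) (hum s).aestronglyMeasurable
      (hum t).aestronglyMeasurable measurable_fst.aemeasurable
    rw [hfst] at h
    change cov[(fun ξ : B1Eq324BenfattoLemma.Site d → ℝ => condMean K Γ ξ s) ∘ Prod.fst,
      (fun ξ : B1Eq324BenfattoLemma.Site d → ℝ => condMean K Γ ξ t) ∘ Prod.fst; ν] = K s t - condCov K Γ s t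
    rw [← h, hμ]
    exact covariance_condMean hKpsd Γ hdet s t
  have hcζζ : ∀ s t, cov[fun p : (B1Eq324BenfattoLemma.Site d → ℝ) × (B1Eq324BenfattoLemma.Site d → ℝ) => p.2 s,
      fun p => p.2 t; ν] = condCov K Γ s t := by
    intro s t
    have h := covariance_map (μ := ν) (Z := Prod.snd) (X := fun ζ : B1Eq324BenfattoLemma.Site d → ℝ => ζ s)
      (Y := fun ζ : B1Eq324BenfattoLemma.Site d → ℝ => ζ t) (measurable_pi_apply s).aestronglyMeasurable
      (measurable_pi_apply t).aestronglyMeasurable measurable_snd.aemeasurable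
    rw [hsnd] at h
    change cov[(fun ζ : B1Eq324BenfattoLemma.Site d → ℝ => ζ s) ∘ Prod.snd,
      (fun ζ : B1Eq324BenfattoLemma.Site d → ℝ => ζ t) ∘ Prod.snd; ν] = condCov K Γ s t
    rw [← h, hQ]
    exact covariance_eval_gaussianFieldOfKernel hKc s t
  have hcY : ∀ s t, cov[Y s, Y t; ν] = K s t := by
    intro s t
    rw [hY]
    change cov[(fun p => condMean K Γ p.1 s) + fun p => p.2 s, (fun p => condMean K Γ p.1 t) + fun p => p.2 t; ν] = K s t
    rw [covariance_add_left (hL2u s) (hL2ζ s) ((hL2u t).add (hL2ζ t)),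
      covariance_add_right (hL2u s) (hL2u t) (hL2ζ t), covariance_add_right (hL2ζ s) (hL2u t) (hL2ζ t),
      hcuu, hcross, hcζζ]
    have hcross' : cov[fun p : (B1Eq324BenfattoLemma.Site d → ℝ) × (B1Eq324BenfattoLemma.Site d → ℝ) => p.2 s,
        fun p => condMean K Γ p.1 t; ν] = 0 := by
      rw [covariance_comm, hcross]
    rw [hcross']
    ring
  -- conclude
  have hXm : AEMeasurable (fun ω => (X · ω)) ν := measurable_fst.aemeasurable
  have hYm' : AEMeasurable (fun ω => (Y · ω)) ν := (measurable_pi_lambda _ fun s => hYm s).aemeasurable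
  have key := hXproc.map_eq_of_covariance_eq hYproc (fun s => by rw [hmX, hmY])
    (fun s t => by rw [hcX, hcY]) hXm hYm'
  have hXid : (fun ω => (X · ω)) = Prod.fst := by funext ω; rfl
  rw [hXid, hfst] at key
  exact key.symm

/-! ## §2  On `Γ` the coupling reproduces the conditioning values almost surely -/

omit hKpsd hKc in
/-- The conditional variance vanishes on the conditioning set: `C^Γ_cc = 0` for `c ∈ Γ` (`K_ΓΓ` invertible).
[cite: BenfattoEtAl1978, Appendix C (C.6)–(C.7) p.164] -/
theorem condCov_self_eq_zero_of_mem {c : B1Eq324BenfattoLemma.Site d} (hc : c ∈ Γ) :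
    condCov (K) Γ c c = 0 := by
  rw [condCov_eq_sub_condMean, condMean_apply_of_mem (K) Γ (fun c' => K c' c)
    hdet hc, sub_self]

omit hKpsd in
/-- Under the Schur field `Q` a conditioned coordinate vanishes a.s.: `ζ_c = 0` for `c ∈ Γ` (it is `N(0, C^Γ_cc) = N(0, 0) = δ₀`).
[cite: BenfattoEtAl1978, Appendix C (C.6)–(C.7) p.164] -/
theorem schurField_eval_ae_eq_zero {c : B1Eq324BenfattoLemma.Site d} (hc : c ∈ Γ) :
    ∀ᵐ ζ ∂gaussianFieldOfKernel (condCov (K) Γ), ζ c = 0 := by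
  set Q := gaussianFieldOfKernel (condCov (K) Γ) with hQ
  haveI : IsProbabilityMeasure Q := isProbabilityMeasure_gaussianFieldOfKernel hKc
  have hX : HasGaussianLaw (fun ζ : B1Eq324BenfattoLemma.Site d → ℝ => ζ c) Q :=
    (isGaussianProcess_eval_gaussianFieldOfKernel hKc).hasGaussianLaw_eval c
  have hmap := hX.map_eq_gaussianReal
  have hmean : ∫ ζ, ζ c ∂Q = 0 := integral_eval_gaussianFieldOfKernel hKc c
  have hvar : Var[fun ζ : B1Eq324BenfattoLemma.Site d → ℝ => ζ c; Q] = 0 := by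
    rw [← covariance_self (measurable_pi_apply c).aemeasurable, covariance_eval_gaussianFieldOfKernel hKc c c]
    exact condCov_self_eq_zero_of_mem Γ hdet hc
  rw [hmean, hvar, Real.toNNReal_zero, gaussianReal_zero_var] at hmap
  have hzero : Q {ζ | ζ c ≠ 0} = 0 := by
    have hset : {ζ : B1Eq324BenfattoLemma.Site d → ℝ | ζ c ≠ 0} = (fun ζ : B1Eq324BenfattoLemma.Site d → ℝ => ζ c) ⁻¹' {0}ᶜ := rfl
    rw [hset, ← Measure.map_apply (measurable_pi_apply c) (MeasurableSet.singleton 0).compl, hmap,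
      Measure.dirac_apply' _ (MeasurableSet.singleton 0).compl]
    simp
  rw [ae_iff]
  simpa using hzero

omit hKpsd in
/-- **On `Γ` the coupling is the identity, a.s.**: `W(ξ, ζ)_c = ξ_c` for all `c ∈ Γ`, `(P̂₀ ⊗ Q)`-almost surely.
[cite: BenfattoEtAl1978, Appendix C (C.7) p.164] -/
theorem coupling_apply_ae_eq_of_mem :
    ∀ᵐ p ∂(gaussianFieldOfKernel K).prod (gaussianFieldOfKernel (condCov (K) Γ)),
      ∀ c ∈ Γ, condMean (K) Γ p.1 c + p.2 c = p.1 c := by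
  haveI : IsProbabilityMeasure (gaussianFieldOfKernel (condCov (K) Γ)) :=
    isProbabilityMeasure_gaussianFieldOfKernel hKc
  have hfin : ∀ c ∈ Γ, ∀ᵐ p ∂(gaussianFieldOfKernel K).prod (gaussianFieldOfKernel (condCov (K) Γ)),
      condMean (K) Γ p.1 c + p.2 c = p.1 c := by
    intro c hc
    have h2 : ∀ᵐ p ∂(gaussianFieldOfKernel K).prod (gaussianFieldOfKernel (condCov (K) Γ)),
        (p.2 : B1Eq324BenfattoLemma.Site d → ℝ) c = 0 := by
      rw [ae_iff]
      have hset : {p : (B1Eq324BenfattoLemma.Site d → ℝ) × (B1Eq324BenfattoLemma.Site d → ℝ) | ¬p.2 c = 0} =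
          (Set.univ : Set (B1Eq324BenfattoLemma.Site d → ℝ)) ×ˢ {ζ : B1Eq324BenfattoLemma.Site d → ℝ | ζ c ≠ 0} := by
        ext p
        simp
      rw [hset, Measure.prod_prod, ae_iff.1 (schurField_eval_ae_eq_zero Γ hdet hKc hc), mul_zero]
    filter_upwards [h2] with p hp
    rw [hp, add_zero, condMean_apply_of_mem (K) Γ p.1 hdet hc]
  exact (ae_ball_iff (Finset.countable_toSet Γ)).2 hfin

/-! ## §3  The disintegration: `condField` is the conditional law given the values on `Γ` -/

/-- **`P̄(dz) = P̂₀(dz | z̄_Γ)` — THE CONDITIONED FIELD IS THE CONDITIONAL LAW.**  For the free field (1.1) (`α, β > 0`), a finite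
`Γ` and every bounded measurable `g : (Γ → ℝ) × (Q₀ → ℝ) → ℝ`:
`∫ g(ξ|_Γ, ξ) P̂₀(dξ) = ∫ ( ∫ g(ξ|_Γ, z) condField(Γ, ξ)(dz) ) P̂₀(dξ)` — i.e. `ξ ↦ ((gaussianFieldOfKernel (condCov K Γ)).map fun ζ x => condMean K Γ ξ x + ζ x)` (a function of `ξ|_Γ` only) is a
regular conditional distribution of the field given its restriction to `Γ` (the defining identity of Mathlib's `condDistrib` /
`Measure.compProd`, in integral form).  Proof: the coupling `W = u(ξ) + ζ` on `P̂₀ ⊗ Q` has law `P̂₀` (`map_coupling_eq_P0`),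
reproduces `ξ|_Γ` a.s. (`coupling_apply_ae_eq_of_mem`), and `condField(Γ, ξ) = Q ∘ (ζ ↦ u(ξ) + ζ)⁻¹`; Fubini.
[cite: BenfattoEtAl1978, p.152 «P̂₀(dz|(z̄_Δ)_{Δ∈C})»; Appendix C 2) p.164] -/
theorem integral_gaussianFieldOfKernel_eq_condLaw {g : (Γ → ℝ) × (B1Eq324BenfattoLemma.Site d → ℝ) → ℝ} (hg : Measurable g) {M : ℝ}
    (hM : ∀ z, |g z| ≤ M) :
    ∫ ξ, g (Γ.restrict ξ, ξ) ∂gaussianFieldOfKernel K =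
      ∫ ξ, (∫ z, g (Γ.restrict ξ, z) ∂((gaussianFieldOfKernel (condCov K Γ)).map fun ζ x => condMean K Γ ξ x + ζ x)) ∂gaussianFieldOfKernel K := by
  set μ := gaussianFieldOfKernel K with hμ
  set Q := gaussianFieldOfKernel (condCov K Γ) with hQ
  haveI : IsProbabilityMeasure μ := isProbabilityMeasure_gaussianFieldOfKernel hKpsd
  haveI : IsProbabilityMeasure Q := isProbabilityMeasure_gaussianFieldOfKernel hKc
  set ν := μ.prod Q with hν
  -- the coupling map and its measurability
  set W : (B1Eq324BenfattoLemma.Site d → ℝ) × (B1Eq324BenfattoLemma.Site d → ℝ) → (B1Eq324BenfattoLemma.Site d → ℝ) :=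
    fun p x => condMean K Γ p.1 x + p.2 x with hW
  have hum : ∀ x, Measurable fun ξ : B1Eq324BenfattoLemma.Site d → ℝ => condMean K Γ ξ x := by
    intro x
    simp only [condMean]
    fun_prop
  have hWm : Measurable W :=
    measurable_pi_lambda _ fun x => ((hum x).comp measurable_fst).add ((measurable_pi_apply x).comp measurable_snd)
  have hWξ : ∀ ξ : B1Eq324BenfattoLemma.Site d → ℝ, Measurable fun ζ : B1Eq324BenfattoLemma.Site d → ℝ => W (ξ, ζ) :=
    fun ξ => hWm.comp (measurable_const.prodMk measurable_id)
  have hres : Measurable fun ξ : B1Eq324BenfattoLemma.Site d → ℝ => Γ.restrict ξ := Finset.measurable_restrict Γ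
  -- the integrand on the product space
  set h : (B1Eq324BenfattoLemma.Site d → ℝ) × (B1Eq324BenfattoLemma.Site d → ℝ) → ℝ := fun p => g (Γ.restrict p.1, W p) with hh
  have hhm : Measurable h := hg.comp ((hres.comp measurable_fst).prodMk hWm)
  have hhint : Integrable h ν :=
    Integrable.of_bound hhm.aestronglyMeasurable M (ae_of_all _ fun p => by
      rw [Real.norm_eq_abs]; exact hM _)
  -- RHS = ∫∫ h
  have hinner : ∀ ξ : B1Eq324BenfattoLemma.Site d → ℝ,
      ∫ z, g (Γ.restrict ξ, z) ∂(Q.map fun ζ x => condMean K Γ ξ x + ζ x) = ∫ ζ, h (ξ, ζ) ∂Q := by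
    intro ξ
    have hcf : (Q.map fun ζ x => condMean K Γ ξ x + ζ x) = Q.map fun ζ => W (ξ, ζ) := rfl
    rw [hcf, integral_map (hWξ ξ).aemeasurable]
    exact (hg.comp (measurable_const.prodMk measurable_id)).aestronglyMeasurable
  simp_rw [hinner]
  rw [← integral_prod h hhint]
  -- ∫ h dν = ∫ g(Γ.restrict (W p), W p) dν = ∫ G d(ν.map W) = ∫ G dμ
  have hae : (fun p => h p) =ᵐ[ν] fun p => g (Γ.restrict (W p), W p) := by
    filter_upwards [coupling_apply_ae_eq_of_mem Γ hdet hKc] with p hp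
    simp only [hh]
    congr 2
    funext c
    simp only [Finset.restrict, hW]
    exact (hp c c.2).symm
  rw [integral_congr_ae hae]
  have hG : Measurable fun z : B1Eq324BenfattoLemma.Site d → ℝ => g (Γ.restrict z, z) := hg.comp (hres.prodMk measurable_id)
  have hmapW := map_coupling_eq hKpsd Γ hdet hKc
  have := integral_map (μ := ν) (φ := W) hWm.aemeasurable (f := fun z => g (Γ.restrict z, z)) hG.aestronglyMeasurable
  rw [← hν, ← hμ] at hmapW
  rw [hmapW] at this
  exact this

end Coupling

/-! ## §B  The instance `K := C^C`, transported by the centre `u_C(z̄)`: `P̂₀(·|z̄_C)` given `z_Γ` is `P̂₀(·|z̄_C, z_Γ)` -/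

section Instance

variable {α β : ℝ}

/-- kernel: the regression mean reads its data only on the conditioning set. [folklore] -/
private theorem condMean_congr (G : B1Eq324BenfattoLemma.Site d → B1Eq324BenfattoLemma.Site d → ℝ) (C : Finset (B1Eq324BenfattoLemma.Site d))
    {w w' : B1Eq324BenfattoLemma.Site d → ℝ} (h : ∀ c ∈ C, w c = w' c) (x : B1Eq324BenfattoLemma.Site d) :
    condMean G C w x = condMean G C w' x := by
  unfold condMean
  exact Finset.sum_congr rfl fun c _ => Finset.sum_congr rfl fun c' _ => by rw [h c' c'.2]

/-- **`P̂₀(·|z̄_C)(· | z_Γ) = P̂₀(·|z̄_C, z_Γ)` — TWO-STAGE CONDITIONING, THE DISINTEGRATION.**  For the free field (`α, β > 0`), disjoint finite `C`, `Γ`,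
data `z̄` and every bounded measurable `g : (Γ → ℝ) × (Q₀ → ℝ) → ℝ`:
`∫ g(ξ|_Γ, ξ) P̂₀(dξ|z̄_C) = ∫ ( ∫ g(ξ|_Γ, z) P̂₀(dz|ξ_{C∪Γ}) ) P̂₀(dξ|z̄_C)` — the tree's `condField (C ∪ Γ) ξ` (it reads `ξ` on `C ∪ Γ`; `ξ = z̄` on `C`
a.s.) is a conditional law of `condField C z̄` given the coordinates in `Γ`.  This is the conditioning used on p. 159 («We start from (5.13)» with
`P̄ = P̂₀(·|z̄_C)` and the corridor variables `z_{Γ₁}` fixed).  Proof: `condField C z̄ = 𝒩(0, C^C) ∘ (ζ ↦ u_C(z̄) + ζ)⁻¹`; §A for the kernel `C^C`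
(hypotheses: `isPosSemidefKernel_condCov_freeCov`, `…TwoStage.isUnit_det_covGram_condCov_freeCov`, `condCov C^C Γ = C^{C∪Γ}`); the inner centre
`u_C(z̄) + condMean C^C Γ ζ` is `condMean K (C∪Γ) (u_C(z̄) + ζ)` by `…TwoStage.condMean_union_eq` (a.s. `ζ|_C = 0`).
[cite: BenfattoEtAl1978, p.152 «P̄(dz) = P̂₀(dz|(z̄_Δ)_{Δ∈C})», §5 (5.13) p.155, (5.36) p.159; Appendix C 2) p.164] -/
theorem integral_condField_eq_integral_condField_union (hα : 0 < α) (hβ : 0 < β) (C Γ : Finset (B1Eq324BenfattoLemma.Site d))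
    (hdisj : Disjoint Γ C) (zbar : B1Eq324BenfattoLemma.Site d → ℝ) {g : (Γ → ℝ) × (B1Eq324BenfattoLemma.Site d → ℝ) → ℝ} (hg : Measurable g)
    {M : ℝ} (hM : ∀ z, |g z| ≤ M) :
    ∫ ξ, g (Γ.restrict ξ, ξ) ∂condField d α β C zbar =
      ∫ ξ, (∫ z, g (Γ.restrict ξ, z) ∂condField d α β (C ∪ Γ) ξ) ∂condField d α β C zbar := by
  set K := freeCov d α β with hK
  set KC := condCov K C with hKC
  have hKCpsd : IsPosSemidefKernel KC := isPosSemidefKernel_condCov_freeCov hα hβ C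
  have hdetC : IsUnit (covGram KC Γ).det := isUnit_det_covGram_condCov_freeCov hα hβ C Γ hdisj
  have hdetK : IsUnit (covGram K C).det := isUnit_det_covGram_freeCov hα hβ C
  -- `condCov C^C Γ = C^{C∪Γ}`, hence positive-semidefinite, and the two Schur fields coincide
  have hcc : condCov KC Γ = condCov K (C ∪ Γ) := by
    funext x y
    exact (condCov_union_eq hα hβ C Γ hdisj x y).symm
  have hKCc : IsPosSemidefKernel (condCov KC Γ) := by
    rw [hcc]
    exact isPosSemidefKernel_condCov_freeCov hα hβ (C ∪ Γ)
  set QC := gaussianFieldOfKernel KC with hQC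
  set Q2 := gaussianFieldOfKernel (condCov KC Γ) with hQ2
  haveI : IsProbabilityMeasure QC := isProbabilityMeasure_gaussianFieldOfKernel hKCpsd
  haveI : IsProbabilityMeasure Q2 := isProbabilityMeasure_gaussianFieldOfKernel hKCc
  -- the centre and the shift
  set u : B1Eq324BenfattoLemma.Site d → ℝ := condMean K C zbar with hu
  set T : (B1Eq324BenfattoLemma.Site d → ℝ) → (B1Eq324BenfattoLemma.Site d → ℝ) := fun ζ x => u x + ζ x with hT
  have hTm : Measurable T := measurable_pi_lambda _ fun x => (measurable_pi_apply x).const_add _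
  have hcf : condField d α β C zbar = QC.map T := rfl
  have hres : Measurable fun ξ : B1Eq324BenfattoLemma.Site d → ℝ => Γ.restrict ξ := Finset.measurable_restrict Γ
  have hG : Measurable fun z : B1Eq324BenfattoLemma.Site d → ℝ => g (Γ.restrict z, z) := hg.comp (hres.prodMk measurable_id)
  -- LHS on `QC`
  rw [hcf, integral_map hTm.aemeasurable hG.aestronglyMeasurable]
  -- the shifted observable `g'(r, z) = g(u|_Γ + r, T z)`
  set g' : (Γ → ℝ) × (B1Eq324BenfattoLemma.Site d → ℝ) → ℝ := fun p => g (fun γ => u γ + p.1 γ, T p.2) with hg'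
  have hg'm : Measurable g' := by
    refine hg.comp (Measurable.prodMk ?_ (hTm.comp measurable_snd))
    exact measurable_pi_lambda _ fun γ => ((measurable_pi_apply γ).comp measurable_fst).const_add _
  have hg'M : ∀ p, |g' p| ≤ M := fun p => hM _
  have hLHS : ∀ ζ : B1Eq324BenfattoLemma.Site d → ℝ, g (Γ.restrict (T ζ), T ζ) = g' (Γ.restrict ζ, ζ) := fun ζ => rfl
  simp_rw [hLHS]
  rw [integral_gaussianFieldOfKernel_eq_condLaw hKCpsd Γ hdetC hKCc hg'm hg'M]
  -- RHS on `QC`: the integrand `ξ ↦ ∫ g(ξ|_Γ, z) dcondField (C∪Γ) ξ` is measurable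
  set Q3 := gaussianFieldOfKernel (condCov K (C ∪ Γ)) with hQ3
  have hQ23 : Q2 = Q3 := by rw [hQ2, hQ3, hcc]
  haveI : IsProbabilityMeasure Q3 := hQ23 ▸ inferInstance
  have hum : ∀ x, Measurable fun ξ : B1Eq324BenfattoLemma.Site d → ℝ => condMean K (C ∪ Γ) ξ x := by
    intro x
    simp only [condMean]
    fun_prop
  set W3 : (B1Eq324BenfattoLemma.Site d → ℝ) × (B1Eq324BenfattoLemma.Site d → ℝ) → (B1Eq324BenfattoLemma.Site d → ℝ) :=
    fun p x => condMean K (C ∪ Γ) p.1 x + p.2 x with hW3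
  have hW3m : Measurable W3 :=
    measurable_pi_lambda _ fun x => ((hum x).comp measurable_fst).add ((measurable_pi_apply x).comp measurable_snd)
  have hF : ∀ ξ : B1Eq324BenfattoLemma.Site d → ℝ,
      ∫ z, g (Γ.restrict ξ, z) ∂condField d α β (C ∪ Γ) ξ = ∫ ζ', g (Γ.restrict ξ, W3 (ξ, ζ')) ∂Q3 := by
    intro ξ
    have hcf3 : condField d α β (C ∪ Γ) ξ = Q3.map fun ζ' => W3 (ξ, ζ') := rfl
    have hW3ξ : Measurable fun ζ' : B1Eq324BenfattoLemma.Site d → ℝ => W3 (ξ, ζ') := hW3m.comp (measurable_const.prodMk measurable_id)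
    have hgξ : Measurable fun z : B1Eq324BenfattoLemma.Site d → ℝ => g (Γ.restrict ξ, z) := hg.comp (measurable_const.prodMk measurable_id)
    rw [hcf3, integral_map hW3ξ.aemeasurable hgξ.aestronglyMeasurable]
  have hFm : Measurable fun ξ : B1Eq324BenfattoLemma.Site d → ℝ => ∫ z, g (Γ.restrict ξ, z) ∂condField d α β (C ∪ Γ) ξ := by
    simp_rw [hF]
    have hjoint : Measurable fun p : (B1Eq324BenfattoLemma.Site d → ℝ) × (B1Eq324BenfattoLemma.Site d → ℝ) => g (Γ.restrict p.1, W3 p) :=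
      hg.comp ((hres.comp measurable_fst).prodMk hW3m)
    exact (hjoint.stronglyMeasurable.integral_prod_right' (ν := Q3)).measurable
  rw [integral_map hTm.aemeasurable hFm.aestronglyMeasurable]
  -- compare the two `QC`-integrands: they agree as soon as `ζ|_C = 0`, which holds a.s.
  refine integral_congr_ae ?_
  have hzeroC : ∀ᵐ ζ ∂QC, ∀ c ∈ C, ζ c = 0 :=
    (ae_ball_iff (Finset.countable_toSet C)).2 fun c hc =>
      schurField_eval_ae_eq_zero C hdetK hKCpsd hc
  filter_upwards [hzeroC] with ζ hζ
  -- the inner laws: `Q2.map (ζ' ↦ condMean KC Γ ζ + ζ')` read through `g'` versus `Q3.map (W3 (Tζ, ·))` read through `g`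
  have hφ : Measurable fun ζ₁ : B1Eq324BenfattoLemma.Site d → ℝ => fun x => condMean KC Γ ζ x + ζ₁ x :=
    measurable_pi_lambda _ fun x => (measurable_pi_apply x).const_add _
  have hfζ : Measurable fun z : B1Eq324BenfattoLemma.Site d → ℝ => g' (Γ.restrict ζ, z) := hg'm.comp (measurable_const.prodMk measurable_id)
  rw [hF (T ζ), integral_map hφ.aemeasurable hfζ.aestronglyMeasurable, ← hQ2, hQ23]
  refine integral_congr_ae (ae_of_all _ fun ζ' => ?_)
  -- the centres agree: `u + condMean KC Γ ζ = condMean K (C∪Γ) (Tζ)`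
  have hTC : ∀ c ∈ C, T ζ c = zbar c := fun c hc => by
    simp only [hT, hu]
    rw [hζ c hc, add_zero, condMean_apply_of_mem K C zbar hdetK hc]
  have hcentre : ∀ x, u x + condMean KC Γ ζ x = condMean K (C ∪ Γ) (T ζ) x := by
    intro x
    rw [condMean_union_eq hα hβ C Γ hdisj (T ζ) x]
    have h1 : condMean K C (T ζ) x = u x := by
      simp only [hu]
      exact condMean_congr K C hTC x
    have h2 : ∀ t, T ζ t - condMean (freeCov d α β) C (T ζ) t = ζ t := fun t => by
      have := condMean_congr K C hTC t
      simp only [hT, hK] at this ⊢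
      rw [this]
      simp only [hu, hK]
      ring
    rw [h1]
    congr 1
    simp only [hKC, hK]
    exact condMean_congr _ Γ (fun t _ => (h2 t).symm) x
  simp only [hg', hT, hW3, Finset.restrict]
  congr 1
  refine Prod.ext rfl (funext fun x => ?_)
  have hc := hcentre x
  simp only [hT] at hc
  simp only
  rw [← hc]
  ring

end Instance

end Literature.MathematicalPhysics.QuantumFieldTheory.Balaban1983to89.B1Eq324BenfattoTwoStageLaw

end
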